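import Summits.ValiantsHypothesis.ValiantsHypothesis.Theorems.BarrierLeverHubToolkit
import Summits.ValiantsHypothesis.ValiantsHypothesis.Theorems.BarrierLeverCompressionMove

/-!
# Route BarrierLever — a hub certificate WITH BLOCKED MEMBERS: 2-face × claw at `h = 3` (TT, item 19152)

Demonstration file (`--supports stmt-ValiantsHypothesis-19152`; cell valiant-natproofs, rung V4, 𝒟-side of
door (c); prover gen 8, memo `HOME/prover/gen8/HUB-MEMO-g8.md` §2–§3). Companion of
`…Theorems.BarrierLeverHubCertificateEvenClaw`: here both compression words contain a BLOCKED member, so the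
general move `Compression.compressionMove` (not only gen 7's `shearMove'`) is exercised in the kernel.

Layout: `h = 3`, `r = 4`, rows `u = (∅, {2}, {1}, {1,2})` (the 2-face `0 ∉ u`; this is the family that is
DEAD against the lex hub ℒ_4, memo §3), columns `w = (∅, {0}, {1}, {2})` (the claw); in the item's
encoding `SU = ((3,4,5),(3,4,2),(3,1,5),(3,1,2))`, `SW = ((0,1,2),(3,1,2),(0,4,2),(0,1,5))`. HUB
`H = ((1,2,3),(1,3,4),(1,3,5),(2,3,5))` (degree multiset (4,3,2,2,1,0), the universal hub for r = 4), a
threshold family for `ψ = (0,3,2,4,1,2)`. WORDS (found by `emit_demo2.py`): `SU →C_{1←2}→ →C_{2←4}[col 1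
blocked by col 3]→ H'` and `SW →C_{0←1}→ →C_{3←0}→ →C_{5←0}→ →C_{1←2}[col 1 blocked by col 3]→ H''`.

WHAT THIS IS NOT: one layout; a format demonstration; nothing on crux stmt-ValiantsHypothesis-14610 or
`VP` vs `VNP`.
-/

-- layout Summits/ValiantsHypothesis/ValiantsHypothesis forces the duplicated namespace component
set_option linter.dupNamespace false

namespace Summit.ValiantsHypothesis.ValiantsHypothesis.Theorems.BarrierLever.HubDemo2

open Matrix Compression Hub

/-- The hub `H = ((1,2,3),(1,3,4),(1,3,5),(2,3,5))` has strictly increasing rows. -/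
theorem hub_strictMono : ∀ j : Fin 4,
    StrictMono ((![![1, 2, 3], ![1, 3, 4], ![1, 3, 5], ![2, 3, 5]] : Fin 4 → Fin 3 → Fin 6) j) := by
  decide

/-- The hub is an injective family. -/
theorem hub_injective :
    Function.Injective (![![1, 2, 3], ![1, 3, 4], ![1, 3, 5], ![2, 3, 5]] : Fin 4 → Fin 3 → Fin 6) := by
  decide

set_option maxRecDepth 200000 in
/-- Threshold property of the hub for `ψ = (0,3,2,4,1,2)`. -/
theorem hub_threshold : ∀ a : Fin 3 → Fin 6, StrictMono a →
    (∃ j : Fin 4, a = (![![1, 2, 3], ![1, 3, 4], ![1, 3, 5], ![2, 3, 5]] : Fin 4 → Fin 3 → Fin 6) j) ∨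
    ∀ j : Fin 4, (∑ c, (![0, 3, 2, 4, 1, 2] : Fin 6 → ℕ) (a c)) <
      ∑ c, (![0, 3, 2, 4, 1, 2] : Fin 6 → ℕ)
        ((![![1, 2, 3], ![1, 3, 4], ![1, 3, 5], ![2, 3, 5]] : Fin 4 → Fin 3 → Fin 6) j c) := by
  decide

/-- The uniqueness hypothesis of the hub lemma for `H`. -/
theorem hub_unique : ∀ H' : Fin 4 → Fin 3 → Fin 6, (∀ j, StrictMono (H' j)) → Function.Injective H' →
    (∑ j, ∑ a, (![0, 3, 2, 4, 1, 2] : Fin 6 → ℕ) (H' j a)) =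
      (∑ j, ∑ a, (![0, 3, 2, 4, 1, 2] : Fin 6 → ℕ)
        ((![![1, 2, 3], ![1, 3, 4], ![1, 3, 5], ![2, 3, 5]] : Fin 4 → Fin 3 → Fin 6) j a)) →
    ∃ σ : Equiv.Perm (Fin 4), ∀ j,
      H' j = (![![1, 2, 3], ![1, 3, 4], ![1, 3, 5], ![2, 3, 5]] : Fin 4 → Fin 3 → Fin 6) (σ j) :=
  fun H' hm hi hs => hub_unique_of_threshold _ _ hub_injective hub_threshold H' hm hi hs

/-- Rows side: `(SU, H)` is alive — word `C_{1←2} C_{2←4}`, the second step with a blocked member. -/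
theorem alive_face_hub : ∃ G : Matrix (Fin 6) (Fin 6) ℂ, (Matrix.of fun i j : Fin 4 =>
    (G.submatrix ((![![3, 4, 5], ![3, 4, 2], ![3, 1, 5], ![3, 1, 2]] : Fin 4 → Fin 3 → Fin 6) i)
      ((![![1, 2, 3], ![1, 3, 4], ![1, 3, 5], ![2, 3, 5]] : Fin 4 → Fin 3 → Fin 6) j)).det).det ≠ 0 := by
  apply alive_symm
  -- step 1: C_{1←2}: x = 2 ↦ y = 1 on column 1 (slot 2); nothing blocked
  refine compressionMove (ι := Fin 4)
    (![![1, 2, 3], ![1, 3, 4], ![1, 3, 5], ![2, 3, 5]] : Fin 4 → Fin 3 → Fin 6)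
    (![![3, 4, 5], ![3, 4, 2], ![3, 1, 5], ![3, 1, 2]] : Fin 4 → Fin 3 → Fin 6)
    (by decide) 2 1 (by decide) ![false, true, false, false] ![false, false, false, false]
    ![0, 2, 0, 0] ![0, 0, 0, 0] ![1, 1, 1, 1] (by decide) (by decide) (by decide) (by decide) ?_
  -- step 2: C_{2←4}: x = 4 ↦ y = 2 on column 0 (slot 1); column 1 = (3,4,1) is BLOCKED by column 3 = (3,1,2)
  refine compressionMove (ι := Fin 4)
    (![![1, 2, 3], ![1, 3, 4], ![1, 3, 5], ![2, 3, 5]] : Fin 4 → Fin 3 → Fin 6)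
    (fun j => if (![false, true, false, false] : Fin 4 → Bool) j then
      Function.update ((![![3, 4, 5], ![3, 4, 2], ![3, 1, 5], ![3, 1, 2]] : Fin 4 → Fin 3 → Fin 6) j)
        ((![0, 2, 0, 0] : Fin 4 → Fin 3) j) 1
      else (![![3, 4, 5], ![3, 4, 2], ![3, 1, 5], ![3, 1, 2]] : Fin 4 → Fin 3 → Fin 6) j)
    (by decide) 4 2 (by decide) ![true, false, false, false] ![false, true, false, false]
    ![1, 1, 0, 0] ![0, 3, 0, 0] ![1, Equiv.swap 1 2, 1, 1] (by decide) (by decide) (by decide) (by decide) ?_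
  -- end: H rearranged
  exact alive_of_rearrangement _ _ hub_strictMono hub_injective (Equiv.swap 0 3)
    ![Equiv.swap 0 1, Equiv.swap 0 1 * Equiv.swap 1 2, Equiv.swap 0 1, Equiv.swap 1 2 * Equiv.swap 0 1]
    (by decide)

/-- Columns side: `(SW, H)` is alive — word `C_{0←1} C_{3←0} C_{5←0} C_{1←2}`, the last step blocked. -/
theorem alive_claw_hub : ∃ G : Matrix (Fin 6) (Fin 6) ℂ, (Matrix.of fun i j : Fin 4 =>
    (G.submatrix ((![![0, 1, 2], ![3, 1, 2], ![0, 4, 2], ![0, 1, 5]] : Fin 4 → Fin 3 → Fin 6) i)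
      ((![![1, 2, 3], ![1, 3, 4], ![1, 3, 5], ![2, 3, 5]] : Fin 4 → Fin 3 → Fin 6) j)).det).det ≠ 0 := by
  apply alive_symm
  -- step 1: C_{0←1}: x = 1 ↦ y = 0 on column 1 (slot 1)
  refine compressionMove (ι := Fin 4)
    (![![1, 2, 3], ![1, 3, 4], ![1, 3, 5], ![2, 3, 5]] : Fin 4 → Fin 3 → Fin 6)
    (![![0, 1, 2], ![3, 1, 2], ![0, 4, 2], ![0, 1, 5]] : Fin 4 → Fin 3 → Fin 6)
    (by decide) 1 0 (by decide) ![false, true, false, false] ![false, false, false, false]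
    ![0, 1, 0, 0] ![0, 0, 0, 0] ![1, 1, 1, 1] (by decide) (by decide) (by decide) (by decide) ?_
  -- step 2: C_{3←0}: x = 0 ↦ y = 3 on columns 0, 2, 3 (slot 0)
  refine compressionMove (ι := Fin 4)
    (![![1, 2, 3], ![1, 3, 4], ![1, 3, 5], ![2, 3, 5]] : Fin 4 → Fin 3 → Fin 6)
    (fun j => if (![false, true, false, false] : Fin 4 → Bool) j then
      Function.update ((![![0, 1, 2], ![3, 1, 2], ![0, 4, 2], ![0, 1, 5]] : Fin 4 → Fin 3 → Fin 6) j)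
        ((![0, 1, 0, 0] : Fin 4 → Fin 3) j) 0
      else (![![0, 1, 2], ![3, 1, 2], ![0, 4, 2], ![0, 1, 5]] : Fin 4 → Fin 3 → Fin 6) j)
    (by decide) 0 3 (by decide) ![true, false, true, true] ![false, false, false, false]
    ![0, 0, 0, 0] ![0, 0, 0, 0] ![1, 1, 1, 1] (by decide) (by decide) (by decide) (by decide) ?_
  -- step 3: C_{5←0}: x = 0 ↦ y = 5 on column 1 (slot 1)
  refine compressionMove (ι := Fin 4)
    (![![1, 2, 3], ![1, 3, 4], ![1, 3, 5], ![2, 3, 5]] : Fin 4 → Fin 3 → Fin 6)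
    (fun j => if (![true, false, true, true] : Fin 4 → Bool) j then
      Function.update
        ((fun j => if (![false, true, false, false] : Fin 4 → Bool) j then
          Function.update ((![![0, 1, 2], ![3, 1, 2], ![0, 4, 2], ![0, 1, 5]] : Fin 4 → Fin 3 → Fin 6) j)
            ((![0, 1, 0, 0] : Fin 4 → Fin 3) j) 0
          else (![![0, 1, 2], ![3, 1, 2], ![0, 4, 2], ![0, 1, 5]] : Fin 4 → Fin 3 → Fin 6) j) j)
        ((![0, 0, 0, 0] : Fin 4 → Fin 3) j) 3
      else
        (fun j => if (![false, true, false, false] : Fin 4 → Bool) j then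
          Function.update ((![![0, 1, 2], ![3, 1, 2], ![0, 4, 2], ![0, 1, 5]] : Fin 4 → Fin 3 → Fin 6) j)
            ((![0, 1, 0, 0] : Fin 4 → Fin 3) j) 0
          else (![![0, 1, 2], ![3, 1, 2], ![0, 4, 2], ![0, 1, 5]] : Fin 4 → Fin 3 → Fin 6) j) j)
    (by decide) 0 5 (by decide) ![false, true, false, false] ![false, false, false, false]
    ![0, 1, 0, 0] ![0, 0, 0, 0] ![1, 1, 1, 1] (by decide) (by decide) (by decide) (by decide) ?_
  -- step 4: C_{1←2}: x = 2 ↦ y = 1 on column 2 (slot 2); column 1 = (3,5,2) is BLOCKED by column 3 = (3,1,5).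
  -- At this point the configuration is ((3,1,2),(3,5,2),(3,4,2),(3,1,5)); we restate it explicitly.
  have hcfg : (fun j => if (![false, true, false, false] : Fin 4 → Bool) j then
      Function.update
        ((fun j => if (![true, false, true, true] : Fin 4 → Bool) j then
          Function.update
            ((fun j => if (![false, true, false, false] : Fin 4 → Bool) j then
              Function.update ((![![0, 1, 2], ![3, 1, 2], ![0, 4, 2], ![0, 1, 5]] : Fin 4 → Fin 3 → Fin 6) j)
                ((![0, 1, 0, 0] : Fin 4 → Fin 3) j) 0
              else (![![0, 1, 2], ![3, 1, 2], ![0, 4, 2], ![0, 1, 5]] : Fin 4 → Fin 3 → Fin 6) j) j)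
            ((![0, 0, 0, 0] : Fin 4 → Fin 3) j) 3
          else
            (fun j => if (![false, true, false, false] : Fin 4 → Bool) j then
              Function.update ((![![0, 1, 2], ![3, 1, 2], ![0, 4, 2], ![0, 1, 5]] : Fin 4 → Fin 3 → Fin 6) j)
                ((![0, 1, 0, 0] : Fin 4 → Fin 3) j) 0
              else (![![0, 1, 2], ![3, 1, 2], ![0, 4, 2], ![0, 1, 5]] : Fin 4 → Fin 3 → Fin 6) j) j) j)
        ((![0, 1, 0, 0] : Fin 4 → Fin 3) j) 5
      else
        (fun j => if (![true, false, true, true] : Fin 4 → Bool) j then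
          Function.update
            ((fun j => if (![false, true, false, false] : Fin 4 → Bool) j then
              Function.update ((![![0, 1, 2], ![3, 1, 2], ![0, 4, 2], ![0, 1, 5]] : Fin 4 → Fin 3 → Fin 6) j)
                ((![0, 1, 0, 0] : Fin 4 → Fin 3) j) 0
              else (![![0, 1, 2], ![3, 1, 2], ![0, 4, 2], ![0, 1, 5]] : Fin 4 → Fin 3 → Fin 6) j) j)
            ((![0, 0, 0, 0] : Fin 4 → Fin 3) j) 3
          else
            (fun j => if (![false, true, false, false] : Fin 4 → Bool) j then
              Function.update ((![![0, 1, 2], ![3, 1, 2], ![0, 4, 2], ![0, 1, 5]] : Fin 4 → Fin 3 → Fin 6) j)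
                ((![0, 1, 0, 0] : Fin 4 → Fin 3) j) 0
              else (![![0, 1, 2], ![3, 1, 2], ![0, 4, 2], ![0, 1, 5]] : Fin 4 → Fin 3 → Fin 6) j) j) j) =
      (![![3, 1, 2], ![3, 5, 2], ![3, 4, 2], ![3, 1, 5]] : Fin 4 → Fin 3 → Fin 6) := by decide
  have hcfg' := fun j => congrFun hcfg j
  simp only [hcfg']
  refine compressionMove (ι := Fin 4)
    (![![1, 2, 3], ![1, 3, 4], ![1, 3, 5], ![2, 3, 5]] : Fin 4 → Fin 3 → Fin 6)
    (![![3, 1, 2], ![3, 5, 2], ![3, 4, 2], ![3, 1, 5]] : Fin 4 → Fin 3 → Fin 6)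
    (by decide) 2 1 (by decide) ![false, false, true, false] ![false, true, false, false]
    ![0, 2, 2, 0] ![0, 3, 0, 0] ![1, Equiv.swap 1 2, 1, 1] (by decide) (by decide) (by decide) (by decide) ?_
  -- end: H rearranged
  exact alive_of_rearrangement _ _ hub_strictMono hub_injective (Equiv.swap 1 3 * Equiv.swap 3 2)
    ![Equiv.swap 1 2 * Equiv.swap 0 1, Equiv.swap 0 1 * Equiv.swap 1 2, Equiv.swap 0 1 * Equiv.swap 1 2,
      Equiv.swap 0 1]
    (by decide)

/-- **The layout (2-face) × (claw) at `h = 3` is alive**, certified through the hub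
`H = ((1,2,3),(1,3,4),(1,3,5),(2,3,5))` with blocked compressions on both sides. -/
theorem face_claw_alive : ∃ G : Matrix (Fin 6) (Fin 6) ℂ, (Matrix.of fun i j : Fin 4 =>
    (G.submatrix ((![![3, 4, 5], ![3, 4, 2], ![3, 1, 5], ![3, 1, 2]] : Fin 4 → Fin 3 → Fin 6) i)
      ((![![0, 1, 2], ![3, 1, 2], ![0, 4, 2], ![0, 1, 5]] : Fin 4 → Fin 3 → Fin 6) j)).det).det ≠ 0 :=
  alive_trans_of_hub _ _ _ (![0, 3, 2, 4, 1, 2] : Fin 6 → ℕ) hub_strictMono hub_injective hub_unique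
    alive_face_hub alive_claw_hub

/-- The same statement in the item's own indexing (`u = (∅,{2},{1},{1,2})`, `w = (∅,{0},{1},{2})`). -/
theorem face_claw_alive' : ∃ G : Matrix (Fin (3 + 3)) (Fin (3 + 3)) ℂ, (Matrix.of fun i j : Fin 4 =>
    (G.submatrix
      (fun a : Fin 3 => if a ∈ (![∅, {2}, {1}, {1, 2}] : Fin 4 → Finset (Fin 3)) i
        then Fin.castAdd 3 a else Fin.natAdd 3 a)
      (fun c : Fin 3 => if c ∈ (![∅, {0}, {1}, {2}] : Fin 4 → Finset (Fin 3)) j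
        then Fin.natAdd 3 c else Fin.castAdd 3 c)).det).det ≠ 0 := by
  have hr : (fun (i : Fin 4) (a : Fin 3) => if a ∈ (![∅, {2}, {1}, {1, 2}] : Fin 4 → Finset (Fin 3)) i
        then Fin.castAdd 3 a else Fin.natAdd 3 a) =
      (![![3, 4, 5], ![3, 4, 2], ![3, 1, 5], ![3, 1, 2]] : Fin 4 → Fin 3 → Fin 6) := by decide
  have hc : (fun (j : Fin 4) (c : Fin 3) => if c ∈ (![∅, {0}, {1}, {2}] : Fin 4 → Finset (Fin 3)) j
        then Fin.natAdd 3 c else Fin.castAdd 3 c) =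
      (![![0, 1, 2], ![3, 1, 2], ![0, 4, 2], ![0, 1, 5]] : Fin 4 → Fin 3 → Fin 6) := by decide
  obtain ⟨G, hG⟩ := face_claw_alive
  refine ⟨G, ?_⟩
  have e1 : ∀ i : Fin 4, (fun a : Fin 3 => if a ∈ (![∅, {2}, {1}, {1, 2}] : Fin 4 → Finset (Fin 3)) i
        then Fin.castAdd 3 a else Fin.natAdd 3 a) =
      (![![3, 4, 5], ![3, 4, 2], ![3, 1, 5], ![3, 1, 2]] : Fin 4 → Fin 3 → Fin 6) i :=
    fun i => congrFun hr i
  have e2 : ∀ j : Fin 4, (fun c : Fin 3 => if c ∈ (![∅, {0}, {1}, {2}] : Fin 4 → Finset (Fin 3)) j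
        then Fin.natAdd 3 c else Fin.castAdd 3 c) =
      (![![0, 1, 2], ![3, 1, 2], ![0, 4, 2], ![0, 1, 5]] : Fin 4 → Fin 3 → Fin 6) j :=
    fun j => congrFun hc j
  simp only [e1, e2]
  exact hG

end Summit.ValiantsHypothesis.ValiantsHypothesis.Theorems.BarrierLever.HubDemo2
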